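import Literature.NumberTheory.Automorphic.ArchRankOneCasimirAllOrders          -- ★ p850669∕p850639 (this seat): the ladder, one-sided limits, bounded jets, additivity at regular `ψ`
import Mathlib.Topology.ContinuousMap.Bounded.Normed
import Literature.Analysis.Calculus.ContDiffCurryCompact                      -- ★ p850802 (CURRY-∞, F0P3a-p02 (g20)): `exists_contDiff_curry_circle_smul` (ED. 2)
import HarnessLib

/-!
# ALL ORDERS at the central wall, UNIFORMLY over compact families: the `E′`-reading of the Casimir ladder through a continuous linear map
# (Varadarajan 1989 §6.4 Thms 22–24 for Banach-valued test functions; Bouaziz 1994 (I₂) «toutes ses dérivées y sont bornées», uniformly in the other variables)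

Topic `NumberTheory/Automorphic`; namespace `Literature.NumberTheory.Automorphic.RankOneCasimir`.  THEOREMS ONLY (no `def`, no instance, no notation, no axiom, no named fact,
no `sorry`).  Cell `pub/hodgecm-mathlib`, line LH3 (closer stub `stub_N9`, crux H413 = `stmt-HodgeConjecture-24833`), brick **(ELL-∞-UNIF)** (LH3-plan (g3) TWO WORDS (2),
2026-09-02T09:08:47Z: «LH3-p04 = CONSUMER — the `E′ := C(S¹,E)` ∕ `K →ᵇ E` reading of the ★ `E`-polymorphic heads»; (CURRY-∞) = F0P3a-p02 (g20)); consumer: LH3-p01 (g4)'s (α3)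
«uniformity over the other leaves» of the letter-L3′ transport (09:06:33Z, binder form (a)); author LH3-p04 (g4).

THE MATHEMATICS.  The ★ heads of `ArchRankOneCasimirLadder`∕`AllOrders` hold for test functions with values in ANY real Banach space `E`.  Read them in `E′` and push through a
continuous linear map `ℓ : E′ →L[ℝ] E`: the normalised orbital integral commutes with `ℓ` — `F (ℓ ∘ g) ψ = ℓ (F′ g ψ)` for EVERY `ψ` (§1: at a regular `ψ` the integrand is
integrable, ★ `integrable_comp_conj_circleDiagonal`; at `sin ψ = 0` both sides are `0`), `F′ g` is `C^∞` on the punctured interval `0 < |ψ| < 1` (§2, from the ★ ladder), so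
`(F (ℓ ∘ g))⁽ⁿ⁾ ψ = ℓ ((F′ g)⁽ⁿ⁾ ψ)` there (§3) and ONE bound `B` of `‖(F′ g)⁽ⁿ⁾‖` near the wall bounds `‖(F (ℓ ∘ g))⁽ⁿ⁾‖ ≤ ‖ℓ‖·B` SIMULTANEOUSLY for all `ℓ` (§4) — uniformity over
every family of test functions that is the image of one `g ∈ C_c^∞(M₂(ℂ), E′)` under CLMs of norm `≤ 1`; e.g. a compact-parameter family `k ↦ Φ(k, ·)` curried into `E′ = K →ᵇ E`
with `ℓ = evalCLM ℝ k` ((CURRY-∞), F0P3a-p02 (g20)).  §5: the centre only translates the support, `t_z(ψ) = z·t_1(ψ)` central ⇒ `F_z f = F_1 (f ∘ (z • ·))`; §6: hence, GIVEN the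
curried family `g X = (z ↦ f (z • X)) ∈ C_c^∞(M₂(ℂ), S¹ →ᵇ E)` (binder form of (CURRY-∞)'s `exists_contDiff_curry_circle_smul`), the jets of `F_z f` are bounded near the wall
UNIFORMLY in the centre `z ∈ S¹` — LH3-p01 (g4)'s «`z`-UNIFORM (a)».
HONEST LABEL: HC_CM is proved only modulo the 7 printed citations (2 remaining: hLiu418 = stmt-HodgeConjecture-24832, h413 = stmt-HodgeConjecture-24833) until rung 0 closes;
bookkeeping over ★ p850639∕p850669, count-neutral, pays nothing by itself.

WHAT IS PROVED (frame of ★ Z4∕stage #1 verbatim; `F`, `F′` bound functionals at `E`, `E′`; `Ω′` the Casimir operator at `E′`).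
* §1 `orbitalIntegral_comp_clm` — `F (fun X => ℓ (g X)) ψ = ℓ (F′ g ψ)`, all `ψ`.
* §2 `contDiffOn_orbitalIntegral_punctured` — `ContDiffOn ℝ ∞ (F f) (Ioo (-1) 1 ∩ {0}ᶜ)` for `f ∈ C_c^∞`.
* §3 `iteratedDeriv_orbitalIntegral_comp_clm` — `iteratedDeriv n (F (ℓ ∘ g)) ψ = ℓ (iteratedDeriv n (F′ g) ψ)` on the punctured interval; `tendsto_iteratedDeriv_orbitalIntegral_comp_clm`.
* §4 **`exists_forall_eventually_norm_iteratedDeriv_orbitalIntegral_comp_clm_le`** — `∃ B, ∀ᶠ ψ in 𝓝[≠] 0, ∀ ℓ, ‖iteratedDeriv n (F (ℓ ∘ g)) ψ‖ ≤ ‖ℓ‖ * B`.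
* §5 `orbitalIntegral_centre_eq` — `F_z f ψ = F_1 (f ∘ ((z:ℂ) • ·)) ψ`.
* §6 **`exists_forall_eventually_norm_iteratedDeriv_orbitalIntegral_le_uniform_circle`** — `∃ B, ∀ᶠ ψ in 𝓝[≠] 0, ∀ z : Circle, ‖iteratedDeriv n (F z f) ψ‖ ≤ B`.
* §7 (ED. 2, append-only, over ★ p850802 (CURRY-∞)) **`exists_forall_eventually_norm_iteratedDeriv_orbitalIntegral_le_uniform_circle_of_contDiff`** — the same with the
  curried family DISCHARGED: hypotheses `ContDiff ℝ ∞ f ∧ HasCompactSupport f` only.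

## References
* [Varadarajan1989] V. S. Varadarajan, *An Introduction to Harmonic Analysis on Semisimple Lie Groups*, Cambridge Stud. Adv. Math. 16 (1989), §6.4 Thms 22–24.
* [Bouaziz1994IntegralesOrbitales] A. Bouaziz, *Intégrales orbitales sur les groupes de Lie réductifs*, Ann. Sci. ÉNS 27 (1994), §3.1 (I₁)–(I₂) p. 579.
* [Rogawski1990] J. D. Rogawski, *Automorphic Representations of Unitary Groups in Three Variables*, Ann. of Math. Stud. 123 (1990), §8.2 pp. 119–123.
-/

set_option autoImplicit false

noncomputable section

namespace Literature.NumberTheory.Automorphic.RankOneCasimir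

open _root_.Complex _root_.Matrix _root_.MeasureTheory _root_.Set _root_.Filter _root_.Topology _root_.NumberField _root_.NumberField.InfinitePlace
open _root_.Literature.NumberTheory.Automorphic _root_.Literature.NumberTheory.Automorphic.UnitaryGroup
open scoped Matrix.Norms.Operator MatrixGroups ComplexConjugate ContDiff Real BoundedContinuousFunction

variable (L : Type) [Field L] (a : Fin 2 → L) (w : {w : InfinitePlace L // IsComplex w})
variable {E : Type*} [NormedAddCommGroup E] [NormedSpace ℝ E] [CompleteSpace E]
variable {E' : Type*} [NormedAddCommGroup E'] [NormedSpace ℝ E'] [CompleteSpace E']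

/-! ## §1 The normalised orbital integral commutes with continuous linear maps on the test-function side -/

/-- **`F (ℓ ∘ g) ψ = ℓ (F′ g ψ)` for EVERY `ψ`**: at a regular `ψ` (`sin ψ ≠ 0`) the integrand `h ↦ g(↑↑(h t_z(ψ) h⁻¹))` is integrable (★ `integrable_comp_conj_circleDiagonal` over ★
`isCompact_setOf_coe_archLocal_mem`) and the Bochner integral commutes with `ℓ`; at `sin ψ = 0` both sides are `0 • junk = 0`. [cite: Varadarajan1989, §6.4] [cite: Rogawski1990, §8.2 p. 122] -/
theorem orbitalIntegral_comp_clm (ha : ∀ i, a i ≠ 0)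
    [MeasurableSpace (unitaryGroupOfForm (starRingEnd ℂ) ((Matrix.diagonal a).map w.1.embedding))]
    [BorelSpace (unitaryGroupOfForm (starRingEnd ℂ) ((Matrix.diagonal a).map w.1.embedding))]
    (μ : Measure (unitaryGroupOfForm (starRingEnd ℂ) ((Matrix.diagonal a).map w.1.embedding))) [IsFiniteMeasureOnCompacts μ]
    (z : Circle) (F : (Matrix (Fin 2) (Fin 2) ℂ → E) → ℝ → E)
    (hF : ∀ (f : Matrix (Fin 2) (Fin 2) ℂ → E) (ψ : ℝ), F f ψ = (2 * Real.sin ψ) •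
      ∫ h : unitaryGroupOfForm (starRingEnd ℂ) ((Matrix.diagonal a).map w.1.embedding),
        f (((h * ⟨circleDiagonal 2 ![z * Circle.exp ψ, z * Circle.exp (-ψ)], circleDiagonal_mem_archLocal_diagonal L 2 a w _⟩ * h⁻¹ :
          unitaryGroupOfForm (starRingEnd ℂ) ((Matrix.diagonal a).map w.1.embedding)) : GL (Fin 2) ℂ) : Matrix (Fin 2) (Fin 2) ℂ) ∂μ)
    (F' : (Matrix (Fin 2) (Fin 2) ℂ → E') → ℝ → E')
    (hF' : ∀ (g : Matrix (Fin 2) (Fin 2) ℂ → E') (ψ : ℝ), F' g ψ = (2 * Real.sin ψ) •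
      ∫ h : unitaryGroupOfForm (starRingEnd ℂ) ((Matrix.diagonal a).map w.1.embedding),
        g (((h * ⟨circleDiagonal 2 ![z * Circle.exp ψ, z * Circle.exp (-ψ)], circleDiagonal_mem_archLocal_diagonal L 2 a w _⟩ * h⁻¹ :
          unitaryGroupOfForm (starRingEnd ℂ) ((Matrix.diagonal a).map w.1.embedding)) : GL (Fin 2) ℂ) : Matrix (Fin 2) (Fin 2) ℂ) ∂μ)
    (ℓ : E' →L[ℝ] E) {g : Matrix (Fin 2) (Fin 2) ℂ → E'} (hg : Continuous g) (hgc : HasCompactSupport g) (ψ : ℝ) :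
    F (fun X => ℓ (g X)) ψ = ℓ (F' g ψ) := by
  rw [hF, hF']
  by_cases hψ : Real.sin ψ = 0
  · simp [hψ]
  -- regular `ψ`: integrable integrand, `ℓ` commutes with the Bochner integral and with the real scalar
  have hfin : IsFiniteMeasureOnCompacts μ := inferInstance
  letI iA : MeasurableSpace (archLocal L 2 (Matrix.diagonal a) w) :=
    ‹MeasurableSpace (unitaryGroupOfForm (starRingEnd ℂ) ((Matrix.diagonal a).map w.1.embedding))›
  haveI : BorelSpace (archLocal L 2 (Matrix.diagonal a) w) := ‹BorelSpace (unitaryGroupOfForm (starRingEnd ℂ) ((Matrix.diagonal a).map w.1.embedding))›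
  haveI : @IsFiniteMeasureOnCompacts (archLocal L 2 (Matrix.diagonal a) w) iA _ μ := hfin
  have hz : Function.Injective (![z * Circle.exp ψ, z * Circle.exp (-ψ)] : Fin 2 → Circle) := by
    intro i j hij
    fin_cases i <;> fin_cases j
    · rfl
    · exact absurd hij (torusPoint_ne z hψ)
    · exact absurd hij.symm (torusPoint_ne z hψ)
    · rfl
  have hcoe : Continuous fun x : archLocal L 2 (Matrix.diagonal a) w => ((x : GL (Fin 2) ℂ) : Matrix (Fin 2) (Fin 2) ℂ) :=
    Units.continuous_val.comp continuous_subtype_val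
  have hint : Integrable (fun h : archLocal L 2 (Matrix.diagonal a) w =>
      g (((h * ⟨circleDiagonal 2 ![z * Circle.exp ψ, z * Circle.exp (-ψ)], circleDiagonal_mem_archLocal_diagonal L 2 a w _⟩ * h⁻¹ :
        archLocal L 2 (Matrix.diagonal a) w) : GL (Fin 2) ℂ) : Matrix (Fin 2) (Fin 2) ℂ)) μ := by
    have hK := isCompact_setOf_coe_archLocal_mem L 2 a w ha hgc.isCompact
    exact integrable_comp_conj_circleDiagonal L 2 a w ha μ hz (fun x : archLocal L 2 (Matrix.diagonal a) w => g ((x : GL (Fin 2) ℂ) : Matrix (Fin 2) (Fin 2) ℂ))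
      (hg.comp hcoe) (HasCompactSupport.intro hK fun x hx => image_eq_zero_of_notMem_tsupport hx)
  rw [map_smul]
  congr 1
  exact ℓ.integral_comp_comm hint

/-! ## §2 `F f` is `C^∞` on the punctured interval `0 < |ψ| < 1` -/

/-- **`ContDiffOn ℝ ∞ (F f) (Ioo (−1) 1 ∩ {0}ᶜ)`** for `f ∈ C_c^∞`: every `iteratedDeriv m (F f)` is differentiable there (★ `orbitalIntegral_iteratedDeriv_ladder`), and on an open set
that is `C^∞` (Mathlib `contDiffOn_of_differentiableOn_deriv`). [cite: Varadarajan1989, §6.4 Thm 24] -/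
theorem contDiffOn_orbitalIntegral_punctured
    (ha : ∀ i, a i ≠ 0) (hreal : ∀ i, (w.1.embedding (a i)).im = 0) (hsgn : (w.1.embedding (a 0)).re * (w.1.embedding (a 1)).re < 0)
    {p q : ℝ} (hpq : p * q = 1) (hqe : (q : ℂ) ^ 2 * w.1.embedding (a 1) = -w.1.embedding (a 0))
    [MeasurableSpace (unitaryGroupOfForm (starRingEnd ℂ) ((Matrix.diagonal a).map w.1.embedding))]
    [BorelSpace (unitaryGroupOfForm (starRingEnd ℂ) ((Matrix.diagonal a).map w.1.embedding))]
    (μ : Measure (unitaryGroupOfForm (starRingEnd ℂ) ((Matrix.diagonal a).map w.1.embedding))) [μ.IsHaarMeasure] [μ.IsMulRightInvariant]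
    (Ω : (Matrix (Fin 2) (Fin 2) ℂ → E) → Matrix (Fin 2) (Fin 2) ℂ → E)
    (hΩ : ∀ (g : Matrix (Fin 2) (Fin 2) ℂ → E) (Y : Matrix (Fin 2) (Fin 2) ℂ), Ω g Y =
      -(fderiv ℝ (fderiv ℝ g) Y (Y * !![I, 0; 0, -I]) (Y * !![I, 0; 0, -I]) + fderiv ℝ g Y (Y * !![I, 0; 0, -I] * !![I, 0; 0, -I])) +
        (fderiv ℝ (fderiv ℝ g) Y (Y * !![(0 : ℂ), (p : ℂ); (q : ℂ), 0]) (Y * !![(0 : ℂ), (p : ℂ); (q : ℂ), 0]) +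
          fderiv ℝ g Y (Y * !![(0 : ℂ), (p : ℂ); (q : ℂ), 0] * !![(0 : ℂ), (p : ℂ); (q : ℂ), 0])) +
        (fderiv ℝ (fderiv ℝ g) Y (Y * !![(0 : ℂ), -((p : ℂ) * I); (q : ℂ) * I, 0]) (Y * !![(0 : ℂ), -((p : ℂ) * I); (q : ℂ) * I, 0]) +
          fderiv ℝ g Y (Y * !![(0 : ℂ), -((p : ℂ) * I); (q : ℂ) * I, 0] * !![(0 : ℂ), -((p : ℂ) * I); (q : ℂ) * I, 0])))
    (z : Circle) (F : (Matrix (Fin 2) (Fin 2) ℂ → E) → ℝ → E)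
    (hF : ∀ (g : Matrix (Fin 2) (Fin 2) ℂ → E) (ψ : ℝ), F g ψ = (2 * Real.sin ψ) •
      ∫ h : unitaryGroupOfForm (starRingEnd ℂ) ((Matrix.diagonal a).map w.1.embedding),
        g (((h * ⟨circleDiagonal 2 ![z * Circle.exp ψ, z * Circle.exp (-ψ)], circleDiagonal_mem_archLocal_diagonal L 2 a w _⟩ * h⁻¹ :
          unitaryGroupOfForm (starRingEnd ℂ) ((Matrix.diagonal a).map w.1.embedding)) : GL (Fin 2) ℂ) : Matrix (Fin 2) (Fin 2) ℂ) ∂μ)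
    {f : Matrix (Fin 2) (Fin 2) ℂ → E} (hf : ContDiff ℝ ∞ f) (hfc : HasCompactSupport f) :
    ContDiffOn ℝ ∞ (F f) (Ioo (-1 : ℝ) 1 ∩ {(0 : ℝ)}ᶜ) := by
  have hU : IsOpen (Ioo (-1 : ℝ) 1 ∩ {(0 : ℝ)}ᶜ) := isOpen_Ioo.inter isOpen_compl_singleton
  refine contDiffOn_of_differentiableOn_deriv fun m _ => ?_
  refine (DifferentiableOn.congr ?_ fun ψ hψ => iteratedDerivWithin_of_isOpen hU hψ)
  intro ψ hψ
  exact ((orbitalIntegral_iteratedDeriv_ladder L a w ha hreal hsgn hpq hqe μ Ω hΩ z F hF hf hfc m hψ.1 hψ.2).1).differentiableAt.differentiableWithinAt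

/-! ## §3 Iterated derivatives and their limits commute with `ℓ` on the punctured interval -/

/-- **`(F (ℓ ∘ g))⁽ⁿ⁾ ψ = ℓ ((F′ g)⁽ⁿ⁾ ψ)` for `0 < |ψ| < 1`** (`F (ℓ ∘ g) = ℓ ∘ F′ g` everywhere, `F′ g` is `C^∞` on the open punctured interval, Mathlib
`ContinuousLinearMap.iteratedFDeriv_comp_left`). [cite: Varadarajan1989, §6.4 Thm 24] -/
theorem iteratedDeriv_orbitalIntegral_comp_clm
    (ha : ∀ i, a i ≠ 0) (hreal : ∀ i, (w.1.embedding (a i)).im = 0) (hsgn : (w.1.embedding (a 0)).re * (w.1.embedding (a 1)).re < 0)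
    {p q : ℝ} (hpq : p * q = 1) (hqe : (q : ℂ) ^ 2 * w.1.embedding (a 1) = -w.1.embedding (a 0))
    [MeasurableSpace (unitaryGroupOfForm (starRingEnd ℂ) ((Matrix.diagonal a).map w.1.embedding))]
    [BorelSpace (unitaryGroupOfForm (starRingEnd ℂ) ((Matrix.diagonal a).map w.1.embedding))]
    (μ : Measure (unitaryGroupOfForm (starRingEnd ℂ) ((Matrix.diagonal a).map w.1.embedding))) [μ.IsHaarMeasure] [μ.IsMulRightInvariant]
    (Ω' : (Matrix (Fin 2) (Fin 2) ℂ → E') → Matrix (Fin 2) (Fin 2) ℂ → E')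
    (hΩ' : ∀ (g : Matrix (Fin 2) (Fin 2) ℂ → E') (Y : Matrix (Fin 2) (Fin 2) ℂ), Ω' g Y =
      -(fderiv ℝ (fderiv ℝ g) Y (Y * !![I, 0; 0, -I]) (Y * !![I, 0; 0, -I]) + fderiv ℝ g Y (Y * !![I, 0; 0, -I] * !![I, 0; 0, -I])) +
        (fderiv ℝ (fderiv ℝ g) Y (Y * !![(0 : ℂ), (p : ℂ); (q : ℂ), 0]) (Y * !![(0 : ℂ), (p : ℂ); (q : ℂ), 0]) +
          fderiv ℝ g Y (Y * !![(0 : ℂ), (p : ℂ); (q : ℂ), 0] * !![(0 : ℂ), (p : ℂ); (q : ℂ), 0])) +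
        (fderiv ℝ (fderiv ℝ g) Y (Y * !![(0 : ℂ), -((p : ℂ) * I); (q : ℂ) * I, 0]) (Y * !![(0 : ℂ), -((p : ℂ) * I); (q : ℂ) * I, 0]) +
          fderiv ℝ g Y (Y * !![(0 : ℂ), -((p : ℂ) * I); (q : ℂ) * I, 0] * !![(0 : ℂ), -((p : ℂ) * I); (q : ℂ) * I, 0])))
    (z : Circle) (F : (Matrix (Fin 2) (Fin 2) ℂ → E) → ℝ → E)
    (hF : ∀ (f : Matrix (Fin 2) (Fin 2) ℂ → E) (ψ : ℝ), F f ψ = (2 * Real.sin ψ) •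
      ∫ h : unitaryGroupOfForm (starRingEnd ℂ) ((Matrix.diagonal a).map w.1.embedding),
        f (((h * ⟨circleDiagonal 2 ![z * Circle.exp ψ, z * Circle.exp (-ψ)], circleDiagonal_mem_archLocal_diagonal L 2 a w _⟩ * h⁻¹ :
          unitaryGroupOfForm (starRingEnd ℂ) ((Matrix.diagonal a).map w.1.embedding)) : GL (Fin 2) ℂ) : Matrix (Fin 2) (Fin 2) ℂ) ∂μ)
    (F' : (Matrix (Fin 2) (Fin 2) ℂ → E') → ℝ → E')
    (hF' : ∀ (g : Matrix (Fin 2) (Fin 2) ℂ → E') (ψ : ℝ), F' g ψ = (2 * Real.sin ψ) •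
      ∫ h : unitaryGroupOfForm (starRingEnd ℂ) ((Matrix.diagonal a).map w.1.embedding),
        g (((h * ⟨circleDiagonal 2 ![z * Circle.exp ψ, z * Circle.exp (-ψ)], circleDiagonal_mem_archLocal_diagonal L 2 a w _⟩ * h⁻¹ :
          unitaryGroupOfForm (starRingEnd ℂ) ((Matrix.diagonal a).map w.1.embedding)) : GL (Fin 2) ℂ) : Matrix (Fin 2) (Fin 2) ℂ) ∂μ)
    (ℓ : E' →L[ℝ] E) {g : Matrix (Fin 2) (Fin 2) ℂ → E'} (hg : ContDiff ℝ ∞ g) (hgc : HasCompactSupport g) (n : ℕ) {ψ : ℝ} (hψ : ψ ∈ Ioo (-1 : ℝ) 1) (hψ0 : ψ ≠ 0) :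
    iteratedDeriv n (F (fun X => ℓ (g X))) ψ = ℓ (iteratedDeriv n (F' g) ψ) := by
  have hfun : F (fun X => ℓ (g X)) = ℓ ∘ F' g :=
    funext fun ψ => orbitalIntegral_comp_clm L a w ha μ z F hF F' hF' ℓ hg.continuous hgc ψ
  have hU : IsOpen (Ioo (-1 : ℝ) 1 ∩ {(0 : ℝ)}ᶜ) := isOpen_Ioo.inter isOpen_compl_singleton
  have hcd : ContDiffAt ℝ (n : ℕ∞) (F' g) ψ :=
    (((contDiffOn_orbitalIntegral_punctured L a w ha hreal hsgn hpq hqe μ Ω' hΩ' z F' hF' hg hgc).contDiffAt (hU.mem_nhds ⟨hψ, hψ0⟩)).of_le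
      (WithTop.coe_le_coe.2 le_top))
  rw [hfun, iteratedDeriv_eq_iteratedFDeriv, ℓ.iteratedFDeriv_comp_left hcd le_rfl, ContinuousLinearMap.compContinuousMultilinearMap_coe,
    Function.comp_apply, ← iteratedDeriv_eq_iteratedFDeriv]

/-- **Limits of the jets commute with `ℓ`**: along any `l ≤ 𝓝[≠] 0`, `(F′ g)⁽ⁿ⁾ → A` implies `(F (ℓ ∘ g))⁽ⁿ⁾ → ℓ A` (one-sided limits and jumps of a curried family are read through `ℓ`).
[cite: Varadarajan1989, §6.4 Thm 24] [cite: Bouaziz1994IntegralesOrbitales, §3.1 (I₂) p. 579] -/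
theorem tendsto_iteratedDeriv_orbitalIntegral_comp_clm
    (ha : ∀ i, a i ≠ 0) (hreal : ∀ i, (w.1.embedding (a i)).im = 0) (hsgn : (w.1.embedding (a 0)).re * (w.1.embedding (a 1)).re < 0)
    {p q : ℝ} (hpq : p * q = 1) (hqe : (q : ℂ) ^ 2 * w.1.embedding (a 1) = -w.1.embedding (a 0))
    [MeasurableSpace (unitaryGroupOfForm (starRingEnd ℂ) ((Matrix.diagonal a).map w.1.embedding))]
    [BorelSpace (unitaryGroupOfForm (starRingEnd ℂ) ((Matrix.diagonal a).map w.1.embedding))]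
    (μ : Measure (unitaryGroupOfForm (starRingEnd ℂ) ((Matrix.diagonal a).map w.1.embedding))) [μ.IsHaarMeasure] [μ.IsMulRightInvariant]
    (Ω' : (Matrix (Fin 2) (Fin 2) ℂ → E') → Matrix (Fin 2) (Fin 2) ℂ → E')
    (hΩ' : ∀ (g : Matrix (Fin 2) (Fin 2) ℂ → E') (Y : Matrix (Fin 2) (Fin 2) ℂ), Ω' g Y =
      -(fderiv ℝ (fderiv ℝ g) Y (Y * !![I, 0; 0, -I]) (Y * !![I, 0; 0, -I]) + fderiv ℝ g Y (Y * !![I, 0; 0, -I] * !![I, 0; 0, -I])) +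
        (fderiv ℝ (fderiv ℝ g) Y (Y * !![(0 : ℂ), (p : ℂ); (q : ℂ), 0]) (Y * !![(0 : ℂ), (p : ℂ); (q : ℂ), 0]) +
          fderiv ℝ g Y (Y * !![(0 : ℂ), (p : ℂ); (q : ℂ), 0] * !![(0 : ℂ), (p : ℂ); (q : ℂ), 0])) +
        (fderiv ℝ (fderiv ℝ g) Y (Y * !![(0 : ℂ), -((p : ℂ) * I); (q : ℂ) * I, 0]) (Y * !![(0 : ℂ), -((p : ℂ) * I); (q : ℂ) * I, 0]) +
          fderiv ℝ g Y (Y * !![(0 : ℂ), -((p : ℂ) * I); (q : ℂ) * I, 0] * !![(0 : ℂ), -((p : ℂ) * I); (q : ℂ) * I, 0])))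
    (z : Circle) (F : (Matrix (Fin 2) (Fin 2) ℂ → E) → ℝ → E)
    (hF : ∀ (f : Matrix (Fin 2) (Fin 2) ℂ → E) (ψ : ℝ), F f ψ = (2 * Real.sin ψ) •
      ∫ h : unitaryGroupOfForm (starRingEnd ℂ) ((Matrix.diagonal a).map w.1.embedding),
        f (((h * ⟨circleDiagonal 2 ![z * Circle.exp ψ, z * Circle.exp (-ψ)], circleDiagonal_mem_archLocal_diagonal L 2 a w _⟩ * h⁻¹ :
          unitaryGroupOfForm (starRingEnd ℂ) ((Matrix.diagonal a).map w.1.embedding)) : GL (Fin 2) ℂ) : Matrix (Fin 2) (Fin 2) ℂ) ∂μ)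
    (F' : (Matrix (Fin 2) (Fin 2) ℂ → E') → ℝ → E')
    (hF' : ∀ (g : Matrix (Fin 2) (Fin 2) ℂ → E') (ψ : ℝ), F' g ψ = (2 * Real.sin ψ) •
      ∫ h : unitaryGroupOfForm (starRingEnd ℂ) ((Matrix.diagonal a).map w.1.embedding),
        g (((h * ⟨circleDiagonal 2 ![z * Circle.exp ψ, z * Circle.exp (-ψ)], circleDiagonal_mem_archLocal_diagonal L 2 a w _⟩ * h⁻¹ :
          unitaryGroupOfForm (starRingEnd ℂ) ((Matrix.diagonal a).map w.1.embedding)) : GL (Fin 2) ℂ) : Matrix (Fin 2) (Fin 2) ℂ) ∂μ)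
    (ℓ : E' →L[ℝ] E) {g : Matrix (Fin 2) (Fin 2) ℂ → E'} (hg : ContDiff ℝ ∞ g) (hgc : HasCompactSupport g) {l : Filter ℝ} (hl : l ≤ 𝓝[≠] (0 : ℝ)) (n : ℕ) {A : E'}
    (hA : Tendsto (fun ψ => iteratedDeriv n (F' g) ψ) l (𝓝 A)) :
    Tendsto (fun ψ => iteratedDeriv n (F (fun X => ℓ (g X))) ψ) l (𝓝 (ℓ A)) := by
  have hmem : Ioo (-1 : ℝ) 1 ∩ {(0 : ℝ)}ᶜ ∈ 𝓝[≠] (0 : ℝ) :=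
    inter_mem (mem_nhdsWithin_of_mem_nhds (Ioo_mem_nhds (by norm_num) (by norm_num))) self_mem_nhdsWithin
  refine ((ℓ.continuous.tendsto A).comp hA).congr' ?_
  filter_upwards [hl hmem] with ψ hψ
  exact (iteratedDeriv_orbitalIntegral_comp_clm L a w ha hreal hsgn hpq hqe μ Ω' hΩ' z F hF F' hF' ℓ hg hgc n hψ.1 hψ.2).symm

/-! ## §4 ONE bound for the whole family `{ℓ ∘ g}` -/

/-- **UNIFORM BOUNDED JETS OVER A CURRIED FAMILY**: for `g ∈ C_c^∞(M₂(ℂ), E′)` and every `n` there is `B` with `‖(F (ℓ ∘ g))⁽ⁿ⁾ ψ‖ ≤ ‖ℓ‖·B` on ONE punctured neighbourhood of the wall,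
SIMULTANEOUSLY for all `ℓ : E′ →L[ℝ] E` — the bound of ★ `exists_forall_eventually_norm_iteratedDeriv_orbitalIntegral_le` read at `E′` and pushed through `ℓ`.  With `E′ = K →ᵇ E`
and `ℓ = evalCLM ℝ k` (`‖ℓ‖ ≤ 1`) this is Bouaziz (I₂) at one place UNIFORMLY in a compact parameter `k`. [cite: Bouaziz1994IntegralesOrbitales, §3.1 (I₁)–(I₂) p. 579]
[cite: Varadarajan1989, §6.4 Thm 22] -/
theorem exists_forall_eventually_norm_iteratedDeriv_orbitalIntegral_comp_clm_le
    (ha : ∀ i, a i ≠ 0) (hreal : ∀ i, (w.1.embedding (a i)).im = 0) (hsgn : (w.1.embedding (a 0)).re * (w.1.embedding (a 1)).re < 0)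
    {p q : ℝ} (hpq : p * q = 1) (hqe : (q : ℂ) ^ 2 * w.1.embedding (a 1) = -w.1.embedding (a 0))
    [MeasurableSpace (unitaryGroupOfForm (starRingEnd ℂ) ((Matrix.diagonal a).map w.1.embedding))]
    [BorelSpace (unitaryGroupOfForm (starRingEnd ℂ) ((Matrix.diagonal a).map w.1.embedding))]
    (μ : Measure (unitaryGroupOfForm (starRingEnd ℂ) ((Matrix.diagonal a).map w.1.embedding))) [μ.IsHaarMeasure] [μ.IsMulRightInvariant]
    (Ω' : (Matrix (Fin 2) (Fin 2) ℂ → E') → Matrix (Fin 2) (Fin 2) ℂ → E')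
    (hΩ' : ∀ (g : Matrix (Fin 2) (Fin 2) ℂ → E') (Y : Matrix (Fin 2) (Fin 2) ℂ), Ω' g Y =
      -(fderiv ℝ (fderiv ℝ g) Y (Y * !![I, 0; 0, -I]) (Y * !![I, 0; 0, -I]) + fderiv ℝ g Y (Y * !![I, 0; 0, -I] * !![I, 0; 0, -I])) +
        (fderiv ℝ (fderiv ℝ g) Y (Y * !![(0 : ℂ), (p : ℂ); (q : ℂ), 0]) (Y * !![(0 : ℂ), (p : ℂ); (q : ℂ), 0]) +
          fderiv ℝ g Y (Y * !![(0 : ℂ), (p : ℂ); (q : ℂ), 0] * !![(0 : ℂ), (p : ℂ); (q : ℂ), 0])) +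
        (fderiv ℝ (fderiv ℝ g) Y (Y * !![(0 : ℂ), -((p : ℂ) * I); (q : ℂ) * I, 0]) (Y * !![(0 : ℂ), -((p : ℂ) * I); (q : ℂ) * I, 0]) +
          fderiv ℝ g Y (Y * !![(0 : ℂ), -((p : ℂ) * I); (q : ℂ) * I, 0] * !![(0 : ℂ), -((p : ℂ) * I); (q : ℂ) * I, 0])))
    (z : Circle) (F : (Matrix (Fin 2) (Fin 2) ℂ → E) → ℝ → E)
    (hF : ∀ (f : Matrix (Fin 2) (Fin 2) ℂ → E) (ψ : ℝ), F f ψ = (2 * Real.sin ψ) •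
      ∫ h : unitaryGroupOfForm (starRingEnd ℂ) ((Matrix.diagonal a).map w.1.embedding),
        f (((h * ⟨circleDiagonal 2 ![z * Circle.exp ψ, z * Circle.exp (-ψ)], circleDiagonal_mem_archLocal_diagonal L 2 a w _⟩ * h⁻¹ :
          unitaryGroupOfForm (starRingEnd ℂ) ((Matrix.diagonal a).map w.1.embedding)) : GL (Fin 2) ℂ) : Matrix (Fin 2) (Fin 2) ℂ) ∂μ)
    (F' : (Matrix (Fin 2) (Fin 2) ℂ → E') → ℝ → E')
    (hF' : ∀ (g : Matrix (Fin 2) (Fin 2) ℂ → E') (ψ : ℝ), F' g ψ = (2 * Real.sin ψ) •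
      ∫ h : unitaryGroupOfForm (starRingEnd ℂ) ((Matrix.diagonal a).map w.1.embedding),
        g (((h * ⟨circleDiagonal 2 ![z * Circle.exp ψ, z * Circle.exp (-ψ)], circleDiagonal_mem_archLocal_diagonal L 2 a w _⟩ * h⁻¹ :
          unitaryGroupOfForm (starRingEnd ℂ) ((Matrix.diagonal a).map w.1.embedding)) : GL (Fin 2) ℂ) : Matrix (Fin 2) (Fin 2) ℂ) ∂μ)
    {g : Matrix (Fin 2) (Fin 2) ℂ → E'} (hg : ContDiff ℝ ∞ g) (hgc : HasCompactSupport g) (n : ℕ) :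
    ∃ B : ℝ, 0 ≤ B ∧ ∀ᶠ ψ in 𝓝[≠] (0 : ℝ), ∀ ℓ : E' →L[ℝ] E, ‖iteratedDeriv n (F (fun X => ℓ (g X))) ψ‖ ≤ ‖ℓ‖ * B := by
  obtain ⟨B, hB⟩ := exists_forall_eventually_norm_iteratedDeriv_orbitalIntegral_le L a w ha hreal hsgn hpq hqe μ Ω' hΩ' z F' hF' hg hgc n
  have hmem : Ioo (-1 : ℝ) 1 ∩ {(0 : ℝ)}ᶜ ∈ 𝓝[≠] (0 : ℝ) :=
    inter_mem (mem_nhdsWithin_of_mem_nhds (Ioo_mem_nhds (by norm_num) (by norm_num))) self_mem_nhdsWithin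
  refine ⟨max B 0, le_max_right _ _, ?_⟩
  filter_upwards [hB, hmem] with ψ hψB hψU ℓ
  rw [iteratedDeriv_orbitalIntegral_comp_clm L a w ha hreal hsgn hpq hqe μ Ω' hΩ' z F hF F' hF' ℓ hg hgc n hψU.1 hψU.2]
  exact (ℓ.le_opNorm _).trans (mul_le_mul_of_nonneg_left (hψB.trans (le_max_left _ _)) (norm_nonneg _))

/-! ## §5 The centre `z` only translates the support -/

omit [CompleteSpace E] in
/-- **`F_z f = F_1 (f ∘ (z • ·))`**: `t_z(ψ) = z·t_1(ψ)` and the scalar `z` is central in `GL₂(ℂ)`, so `↑↑(h t_z(ψ) h⁻¹) = z • ↑↑(h t_1(ψ) h⁻¹)` (★ `coe_conj_torusPoint`).  `F` is the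
bound functional indexed by the centre (hypothesis `hF`). [cite: Rogawski1990, §8.2 p. 119] [cite: Varadarajan1989, §6.4] -/
theorem orbitalIntegral_centre_eq
    [MeasurableSpace (unitaryGroupOfForm (starRingEnd ℂ) ((Matrix.diagonal a).map w.1.embedding))]
    (μ : Measure (unitaryGroupOfForm (starRingEnd ℂ) ((Matrix.diagonal a).map w.1.embedding)))
    (F : Circle → (Matrix (Fin 2) (Fin 2) ℂ → E) → ℝ → E)
    (hF : ∀ (z : Circle) (f : Matrix (Fin 2) (Fin 2) ℂ → E) (ψ : ℝ), F z f ψ = (2 * Real.sin ψ) •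
      ∫ h : unitaryGroupOfForm (starRingEnd ℂ) ((Matrix.diagonal a).map w.1.embedding),
        f (((h * ⟨circleDiagonal 2 ![z * Circle.exp ψ, z * Circle.exp (-ψ)], circleDiagonal_mem_archLocal_diagonal L 2 a w _⟩ * h⁻¹ :
          unitaryGroupOfForm (starRingEnd ℂ) ((Matrix.diagonal a).map w.1.embedding)) : GL (Fin 2) ℂ) : Matrix (Fin 2) (Fin 2) ℂ) ∂μ)
    (f : Matrix (Fin 2) (Fin 2) ℂ → E) (z : Circle) (ψ : ℝ) :
    F z f ψ = F 1 (fun X => f ((z : ℂ) • X)) ψ := by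
  rw [hF, hF]
  congr 1
  refine integral_congr_ae (Eventually.of_forall fun h => ?_)
  have hdiag : Matrix.diagonal ![(z : ℂ) * cexp (ψ * I), (z : ℂ) * cexp (-(ψ * I))] =
      (z : ℂ) • Matrix.diagonal ![((1 : Circle) : ℂ) * cexp (ψ * I), ((1 : Circle) : ℂ) * cexp (-(ψ * I))] := by
    ext i j
    fin_cases i <;> fin_cases j <;> simp
  -- `↑↑(h t_c(ψ) h⁻¹) = ↑↑h · diag(c e^{iψ}, c e^{−iψ}) · ↑↑h⁻¹` in the `unitaryGroupOfForm` spelling (★ `coe_conj_torusPoint`, `rfl`-bridged)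
  have hconj : ∀ c : Circle, (((h * ⟨circleDiagonal 2 ![c * Circle.exp ψ, c * Circle.exp (-ψ)], circleDiagonal_mem_archLocal_diagonal L 2 a w _⟩ * h⁻¹ :
      unitaryGroupOfForm (starRingEnd ℂ) ((Matrix.diagonal a).map w.1.embedding)) : GL (Fin 2) ℂ) : Matrix (Fin 2) (Fin 2) ℂ) =
        ((h : GL (Fin 2) ℂ) : Matrix (Fin 2) (Fin 2) ℂ) * Matrix.diagonal ![(c : ℂ) * cexp (ψ * I), (c : ℂ) * cexp (-(ψ * I))] *
          (((h⁻¹ : archLocal L 2 (Matrix.diagonal a) w) : GL (Fin 2) ℂ) : Matrix (Fin 2) (Fin 2) ℂ) := fun c => coe_conj_torusPoint L a w h c ψ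
  beta_reduce
  rw [hconj z, hconj 1, hdiag, Matrix.mul_smul, Matrix.smul_mul]

/-! ## §6 Bounded jets UNIFORMLY in the centre `z ∈ S¹` (given the curried family of (CURRY-∞)) -/

/-- **`z`-UNIFORM BOUNDED JETS AT THE WALL**: for `f : M₂(ℂ) → E` whose centre-translates are curried into ONE `g ∈ C_c^∞(M₂(ℂ), S¹ →ᵇ E)` with `g X z = f (z • X)` (binder form of
(CURRY-∞)'s `exists_contDiff_curry_circle_smul`, F0P3a-p02 (g20)), and every `n`: there is `B` with `‖(F_z f)⁽ⁿ⁾ ψ‖ ≤ B` on ONE punctured neighbourhood of `ψ = 0` for ALL centres `z`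
(§5 + §4 at `E′ = S¹ →ᵇ E`, `ℓ = evalCLM ℝ z`, `‖evalCLM ℝ z‖ ≤ 1`). [cite: Bouaziz1994IntegralesOrbitales, §3.1 (I₂) p. 579] [cite: Varadarajan1989, §6.4 Thm 22] -/
theorem exists_forall_eventually_norm_iteratedDeriv_orbitalIntegral_le_uniform_circle
    (ha : ∀ i, a i ≠ 0) (hreal : ∀ i, (w.1.embedding (a i)).im = 0) (hsgn : (w.1.embedding (a 0)).re * (w.1.embedding (a 1)).re < 0)
    {p q : ℝ} (hpq : p * q = 1) (hqe : (q : ℂ) ^ 2 * w.1.embedding (a 1) = -w.1.embedding (a 0))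
    [MeasurableSpace (unitaryGroupOfForm (starRingEnd ℂ) ((Matrix.diagonal a).map w.1.embedding))]
    [BorelSpace (unitaryGroupOfForm (starRingEnd ℂ) ((Matrix.diagonal a).map w.1.embedding))]
    (μ : Measure (unitaryGroupOfForm (starRingEnd ℂ) ((Matrix.diagonal a).map w.1.embedding))) [μ.IsHaarMeasure] [μ.IsMulRightInvariant]
    (F : Circle → (Matrix (Fin 2) (Fin 2) ℂ → E) → ℝ → E)
    (hF : ∀ (z : Circle) (f : Matrix (Fin 2) (Fin 2) ℂ → E) (ψ : ℝ), F z f ψ = (2 * Real.sin ψ) •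
      ∫ h : unitaryGroupOfForm (starRingEnd ℂ) ((Matrix.diagonal a).map w.1.embedding),
        f (((h * ⟨circleDiagonal 2 ![z * Circle.exp ψ, z * Circle.exp (-ψ)], circleDiagonal_mem_archLocal_diagonal L 2 a w _⟩ * h⁻¹ :
          unitaryGroupOfForm (starRingEnd ℂ) ((Matrix.diagonal a).map w.1.embedding)) : GL (Fin 2) ℂ) : Matrix (Fin 2) (Fin 2) ℂ) ∂μ)
    {f : Matrix (Fin 2) (Fin 2) ℂ → E} (g : Matrix (Fin 2) (Fin 2) ℂ → (Circle →ᵇ E)) (hg : ContDiff ℝ ∞ g) (hgc : HasCompactSupport g)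
    (hgf : ∀ (X : Matrix (Fin 2) (Fin 2) ℂ) (z : Circle), g X z = f ((z : ℂ) • X)) (n : ℕ) :
    ∃ B : ℝ, ∀ᶠ ψ in 𝓝[≠] (0 : ℝ), ∀ z : Circle, ‖iteratedDeriv n (F z f) ψ‖ ≤ B := by
  -- the Casimir operator and the normalised orbital integral at `E′ = S¹ →ᵇ E`, centre `1` (bound variables)
  obtain ⟨Ω', hΩ'⟩ : ∃ Ω' : (Matrix (Fin 2) (Fin 2) ℂ → (Circle →ᵇ E)) → Matrix (Fin 2) (Fin 2) ℂ → (Circle →ᵇ E),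
      ∀ (g : Matrix (Fin 2) (Fin 2) ℂ → (Circle →ᵇ E)) (Y : Matrix (Fin 2) (Fin 2) ℂ), Ω' g Y =
        -(fderiv ℝ (fderiv ℝ g) Y (Y * !![I, 0; 0, -I]) (Y * !![I, 0; 0, -I]) + fderiv ℝ g Y (Y * !![I, 0; 0, -I] * !![I, 0; 0, -I])) +
          (fderiv ℝ (fderiv ℝ g) Y (Y * !![(0 : ℂ), (p : ℂ); (q : ℂ), 0]) (Y * !![(0 : ℂ), (p : ℂ); (q : ℂ), 0]) +
            fderiv ℝ g Y (Y * !![(0 : ℂ), (p : ℂ); (q : ℂ), 0] * !![(0 : ℂ), (p : ℂ); (q : ℂ), 0])) +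
          (fderiv ℝ (fderiv ℝ g) Y (Y * !![(0 : ℂ), -((p : ℂ) * I); (q : ℂ) * I, 0]) (Y * !![(0 : ℂ), -((p : ℂ) * I); (q : ℂ) * I, 0]) +
            fderiv ℝ g Y (Y * !![(0 : ℂ), -((p : ℂ) * I); (q : ℂ) * I, 0] * !![(0 : ℂ), -((p : ℂ) * I); (q : ℂ) * I, 0])) :=
    ⟨_, fun _ _ => rfl⟩
  obtain ⟨F', hF'⟩ : ∃ F' : (Matrix (Fin 2) (Fin 2) ℂ → (Circle →ᵇ E)) → ℝ → (Circle →ᵇ E),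
      ∀ (g : Matrix (Fin 2) (Fin 2) ℂ → (Circle →ᵇ E)) (ψ : ℝ), F' g ψ = (2 * Real.sin ψ) •
        ∫ h : unitaryGroupOfForm (starRingEnd ℂ) ((Matrix.diagonal a).map w.1.embedding),
          g (((h * ⟨circleDiagonal 2 ![1 * Circle.exp ψ, 1 * Circle.exp (-ψ)], circleDiagonal_mem_archLocal_diagonal L 2 a w _⟩ * h⁻¹ :
            unitaryGroupOfForm (starRingEnd ℂ) ((Matrix.diagonal a).map w.1.embedding)) : GL (Fin 2) ℂ) : Matrix (Fin 2) (Fin 2) ℂ) ∂μ :=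
    ⟨_, fun _ _ => rfl⟩
  obtain ⟨B, hB0, hB⟩ := exists_forall_eventually_norm_iteratedDeriv_orbitalIntegral_comp_clm_le L a w ha hreal hsgn hpq hqe μ Ω' hΩ' 1 (F 1) (hF 1) F' hF' hg hgc n
  refine ⟨B, ?_⟩
  filter_upwards [hB] with ψ hψ z
  -- `F_z f = F_1 (evalCLM z ∘ g)`
  have hfun : F z f = F 1 (fun X => BoundedContinuousFunction.evalCLM ℝ z (g X)) := by
    funext ψ'
    rw [orbitalIntegral_centre_eq L a w μ F hF f z ψ']
    simp only [BoundedContinuousFunction.evalCLM_apply, hgf]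
  have hnorm : ‖(BoundedContinuousFunction.evalCLM ℝ z : (Circle →ᵇ E) →L[ℝ] E)‖ ≤ 1 :=
    ContinuousLinearMap.opNorm_le_bound _ zero_le_one fun G => by
      simpa only [BoundedContinuousFunction.evalCLM_apply, one_mul] using G.norm_coe_le_norm z
  rw [hfun]
  exact (hψ _).trans ((mul_le_mul_of_nonneg_right hnorm hB0).trans (one_mul B).le)

/-! ## §7 (ED. 2) The `z`-uniform bound, hypothesis-free (the curried family supplied by ★ (CURRY-∞)) -/

/-- **`z`-UNIFORM BOUNDED JETS AT THE WALL, HYPOTHESIS-FREE**: for `f ∈ C_c^∞(M₂(ℂ), E)` and every `n` there is `B` with `‖(F_z f)⁽ⁿ⁾ ψ‖ ≤ B` on ONE punctured neighbourhood of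
`ψ = 0` for ALL centres `z ∈ S¹` — §6 with its three binders discharged by ★ `Literature.Analysis.Calculus.exists_contDiff_curry_circle_smul` (F0P3a-p02 (g20), p850802).
LH3-p01 (g4)'s «`z`-UNIFORM (a)» (2026-09-02T09:06:33Z). [cite: Bouaziz1994IntegralesOrbitales, §3.1 (I₂) p. 579] [cite: Varadarajan1989, §6.4 Thm 22] -/
theorem exists_forall_eventually_norm_iteratedDeriv_orbitalIntegral_le_uniform_circle_of_contDiff
    (ha : ∀ i, a i ≠ 0) (hreal : ∀ i, (w.1.embedding (a i)).im = 0) (hsgn : (w.1.embedding (a 0)).re * (w.1.embedding (a 1)).re < 0)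
    {p q : ℝ} (hpq : p * q = 1) (hqe : (q : ℂ) ^ 2 * w.1.embedding (a 1) = -w.1.embedding (a 0))
    [MeasurableSpace (unitaryGroupOfForm (starRingEnd ℂ) ((Matrix.diagonal a).map w.1.embedding))]
    [BorelSpace (unitaryGroupOfForm (starRingEnd ℂ) ((Matrix.diagonal a).map w.1.embedding))]
    (μ : Measure (unitaryGroupOfForm (starRingEnd ℂ) ((Matrix.diagonal a).map w.1.embedding))) [μ.IsHaarMeasure] [μ.IsMulRightInvariant]
    (F : Circle → (Matrix (Fin 2) (Fin 2) ℂ → E) → ℝ → E)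
    (hF : ∀ (z : Circle) (f : Matrix (Fin 2) (Fin 2) ℂ → E) (ψ : ℝ), F z f ψ = (2 * Real.sin ψ) •
      ∫ h : unitaryGroupOfForm (starRingEnd ℂ) ((Matrix.diagonal a).map w.1.embedding),
        f (((h * ⟨circleDiagonal 2 ![z * Circle.exp ψ, z * Circle.exp (-ψ)], circleDiagonal_mem_archLocal_diagonal L 2 a w _⟩ * h⁻¹ :
          unitaryGroupOfForm (starRingEnd ℂ) ((Matrix.diagonal a).map w.1.embedding)) : GL (Fin 2) ℂ) : Matrix (Fin 2) (Fin 2) ℂ) ∂μ)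
    {f : Matrix (Fin 2) (Fin 2) ℂ → E} (hf : ContDiff ℝ ∞ f) (hfc : HasCompactSupport f) (n : ℕ) :
    ∃ B : ℝ, ∀ᶠ ψ in 𝓝[≠] (0 : ℝ), ∀ z : Circle, ‖iteratedDeriv n (F z f) ψ‖ ≤ B := by
  obtain ⟨g, hg, hgc, hgf⟩ := Literature.Analysis.Calculus.exists_contDiff_curry_circle_smul hf hfc
  exact exists_forall_eventually_norm_iteratedDeriv_orbitalIntegral_le_uniform_circle L a w ha hreal hsgn hpq hqe μ F hF g hg hgc hgf n

end Literature.NumberTheory.Automorphic.RankOneCasimir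

end
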